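import Summits.FinalStateConjecture.FinalStateConjecture.Theorems.ZeroEnergyKerrOrBombHawkingExtensionIsKerrLocalZerothLawCodazzi
import HarnessLib

/-!
# Crux `HawkingExtensionIsKerr` (stmt-FinalStateConjecture-17840), line `SketchIdeator2` —
# collar zeroth law, step E4: the infinitesimal zeroth law in vacuum (trace argument)

Helper file of the line lead (c3), programme "collar zeroth law" (abstract setting of
`…LocalZerothLawStar` / `…Codazzi`).  With `∇_X K = λ K` (E2) the identity `★` with a
transverse test field reduces `X(κ̃) g(K, U)` to `-g(R(U, K) X, K)`; the endomorphism
`T : v ↦ R(v, K) X` maps `K^⊥` into `ℝ K` (E3) and kills `K`, so its trace `Ric(K, X)` equals the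
coefficient `c` of `g(T ·, K) = c g(K, ·)`; the vacuum equation `Ric(K, X) = 0` gives
`dκ̃_x(X) = 0` for all `X ∈ ker df_x` (`mvfderiv_kap_eq_zero`).  Wald 1984, §12.5,
(12.5.30)–(12.5.31) with `R_ab = 0`; Bardeen–Carter–Hawking 1973, §3.
-/

noncomputable section

set_option linter.dupNamespace false

namespace Summit.FinalStateConjecture.FinalStateConjecture.Theorems.HawkingExtensionIsKerr.SketchIdeator2

open Set Function Filter Bundle FiberBundle Literature.Geometry.Lorentzian
open scoped Manifold ContDiff Topology

section Trace

variable {E : Type*} [NormedAddCommGroup E] [NormedSpace ℝ E] [FiniteDimensional ℝ E]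
  [CompleteSpace E] {H : Type*} [TopologicalSpace H] {I : ModelWithCorners ℝ E H}
  [I.Boundaryless] {M : Type*} [TopologicalSpace M] [ChartedSpace H M] [IsManifold I ∞ M]
  {g : PseudoRiemannianMetric I ∞ E (TangentSpace I : M → Type _)} [g.HasLeviCivita]
  {K : Π x : M, TangentSpace I x} {κf : M → ℝ}

omit [FiniteDimensional ℝ E] [CompleteSpace E] [I.Boundaryless] [IsManifold I ∞ M]
  [g.HasLeviCivita] in
/-- **Kernel inclusion of linear functionals**: if `ψ` vanishes on `ker φ` then `ψ = c φ`. -/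
theorem exists_eq_mul_of_ker_le {x : M} (φ ψ : TangentSpace I x →ₗ[ℝ] ℝ)
    (h : ∀ z, φ z = 0 → ψ z = 0) : ∃ c : ℝ, ∀ u, ψ u = c * φ u := by
  by_cases hφ : ∀ u, φ u = 0
  · exact ⟨0, fun u ↦ by rw [h u (hφ u), zero_mul]⟩
  push Not at hφ
  obtain ⟨u₀, hu₀⟩ := hφ
  refine ⟨ψ u₀ / φ u₀, fun u ↦ ?_⟩
  have hz : φ (u - (φ u / φ u₀) • u₀) = 0 := by
    simp only [map_sub, map_smul, smul_eq_mul]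
    rw [div_mul_cancel₀ (φ u) hu₀, sub_self]
  have h' := h _ hz
  simp only [map_sub, map_smul, smul_eq_mul] at h'
  field_simp
  field_simp at h'
  linarith

omit [FiniteDimensional ℝ E] [CompleteSpace E] [I.Boundaryless] [g.HasLeviCivita] in
/-- **`(K^⊥)^⊥ = ℝ K` for a non-degenerate form**: a vector `g`-orthogonal to every vector
`g`-orthogonal to `K` is a multiple of `K`. -/
theorem exists_eq_smul_of_forall_orthogonal {x : M} {K₀ w : TangentSpace I x}
    (h : ∀ z, g.val x K₀ z = 0 → g.val x w z = 0) : ∃ s : ℝ, w = s • K₀ := by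
  obtain ⟨c, hc⟩ := exists_eq_mul_of_ker_le (x := x) (g.val x K₀ : TangentSpace I x →ₗ[ℝ] ℝ)
    (g.val x w : TangentSpace I x →ₗ[ℝ] ℝ) (fun z hz ↦ h z hz)
  refine ⟨c, ?_⟩
  have hzero : w - c • K₀ = 0 := by
    refine g.nondegenerate x _ (fun z ↦ ?_)
    have := hc z
    simp only [ContinuousLinearMap.coe_coe] at this
    rw [map_sub, map_smul, sub_apply, smul_apply, smul_eq_mul, this, sub_self]
  exact sub_eq_zero.mp hzero

/-- **Step E4: `dκ̃_x` kills `ker df_x` (the zeroth law, infinitesimally, in vacuum).**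
Hypotheses as in `riemann_tangent_eq_zero`, plus the vacuum equation at `x` in the single
component `Ric(K, X) = 0`.  Proof: by E2, `∇_X K = λ K`, so `★` with a transverse test field `U`
reduces to `X(κ̃) g(K, U) = -g(R(X, K) U, K) = -g(R(U, K) X, K)`; the endomorphism
`T : v ↦ R(v, K) X` maps `K^⊥` into `ℝ K` (E3) and kills `K`, so its trace — `Ric(K, X)` —
equals the coefficient `c` in `g(T ·, K) = c g(K, ·)`; vacuum gives `c = 0`.  Wald 1984,
§12.5, (12.5.30)–(12.5.31) with `R_ab = 0`. -/
theorem mvfderiv_kap_eq_zero (hK : g.IsKillingField K) {S : Set M} {x : M}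
    (hκ : ∀ᶠ y in 𝓝 x, ContMDiffAt I 𝓘(ℝ, ℝ) ∞ κf y) (hx : x ∈ S)
    (hlevel : ∀ᶠ y in 𝓝 x, g.val y (K y) (K y) = 0 → y ∈ S)
    (hS : ∀ᶠ y in 𝓝 x, y ∈ S → g.val y (K y) (K y) = 0 ∧
      ∀ v, g.val y (g.leviCivita K y v) (K y) = -(κf y) * g.val y (K y) v)
    (hkx : κf x ≠ 0) (hKx : K x ≠ 0)
    {X : TangentSpace I x} (hX : mvfderiv I (fun y ↦ g.val y (K y) (K y)) x X = 0)
    (hric : g.ricci x (K x) X = 0) :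
    mvfderiv I κf x X = 0 := by
  have hLC : g.IsLeviCivita g.leviCivita := PseudoRiemannianMetric.isLeviCivita_leviCivita_holds
  have h2 : (2 : ℕ∞ω) ≤ ∞ := ENat.LEInfty.out
  obtain ⟨hfx, hptx⟩ := hS.self_of_nhds hx
  have hκx : ContMDiffAt I 𝓘(ℝ, ℝ) ∞ κf x := hκ.self_of_nhds
  have hdfxv : ∀ v, mvfderiv I (fun z ↦ g.val z (K z) (K z)) x v = -(2 * κf x) * g.val x (K x) v := by
    intro v
    rw [hK.mvfderiv_val_self_apply x v, hptx v]
    ring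
  -- `ker df_x = K^⊥`
  have hker : ∀ v, mvfderiv I (fun z ↦ g.val z (K z) (K z)) x v = 0 ↔ g.val x (K x) v = 0 := by
    intro v
    rw [hdfxv v]
    constructor
    · intro h
      exact (mul_eq_zero.mp h).resolve_left (neg_ne_zero.mpr (mul_ne_zero two_ne_zero hkx))
    · intro h
      rw [h, mul_zero]
  -- a transverse vector
  obtain ⟨u₀, hu₀⟩ : ∃ u₀, g.val x (K x) u₀ ≠ 0 := by
    by_contra h
    push Not at h
    exact hKx (g.nondegenerate x _ h)
  have hdfx : mvfderiv I (fun y ↦ g.val y (K y) (K y)) x ≠ 0 := by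
    intro h0
    have h := (hker u₀).not.mpr hu₀
    rw [h0] at h
    exact h (zero_apply _)
  -- E2 and E3 at `x`
  have hE2 : ∀ u z : TangentSpace I x, g.val x (K x) u = 0 → g.val x (K x) z = 0 →
      g.val x (g.leviCivita K x u) z = 0 := fun u z hu hz ↦
    secondFF_eq_zero hK hκx hx hlevel hS hdfx hkx ((hker u).mpr hu) ((hker z).mpr hz)
  have hE3 : ∀ w u z : TangentSpace I x, g.val x (K x) w = 0 → g.val x (K x) u = 0 →
      g.val x (K x) z = 0 → g.val x (g.riemann x w (K x) u) z = 0 := fun w u z hw hu hz ↦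
    riemann_tangent_eq_zero hK hκ hx hlevel hS hkx hKx ((hker w).mpr hw) ((hker u).mpr hu)
      ((hker z).mpr hz)
  have hKX : g.val x (K x) X = 0 := (hker X).mp hX
  have hKK : g.val x (K x) (K x) = 0 := hfx
  -- `∇_X K = λ K`
  obtain ⟨lam, hlam⟩ : ∃ s : ℝ, g.leviCivita K x X = s • K x :=
    exists_eq_smul_of_forall_orthogonal (g := g) (fun z hz ↦ hE2 X z hKX hz)
  -- `★` with the transverse test field `U`
  set U : Π y : M, TangentSpace I y := FiberBundle.extend E u₀ with hUdef
  have hU : CMDiffAt ∞ (T% U) x := contMDiffAt_extend ..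
  have hUx : U x = u₀ := extend_apply_self E u₀
  have hstar := star_identity hK hκx hU hx hlevel hS hdfx hX
  rw [hUx, hlam] at hstar
  have hpt := hptx u₀
  simp only [map_smul, smul_apply, smul_eq_mul] at hstar
  haveI : FiniteDimensional ℝ (TangentSpace I x) := inferInstanceAs (FiniteDimensional ℝ E)
  have hu₀' : g.val x u₀ (K x) ≠ 0 := by rwa [g.symm]
  -- hstar : Rm(X,K,u₀,K) + lam * g(∇_{u₀} K, K) + X(κ) g(K,u₀) + κ * (lam * g(K, u₀)) = 0
  -- the trace argument: `g(R(u, K) X, K) = 0` for all `u`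
  set T : TangentSpace I x →ₗ[ℝ] TangentSpace I x := g.leviCivita.ricciAux x (K x) X with hTdef
  have hT : ∀ u, T u = g.riemann x u (K x) X := fun u ↦ rfl
  -- `T` maps `K^⊥` into `ℝ K`
  have hTperp : ∀ v, g.val x (K x) v = 0 → ∃ s : ℝ, T v = s • K x := by
    intro v hv
    refine exists_eq_smul_of_forall_orthogonal (g := g) (fun z hz ↦ ?_)
    rw [hT]
    exact hE3 v X z hv hKX hz
  -- `ψ = g(T ·, K) = c g(K, ·)`
  set φ : TangentSpace I x →ₗ[ℝ] ℝ := (g.val x (K x) : TangentSpace I x →ₗ[ℝ] ℝ) with hφdef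
  have hφ : ∀ u, φ u = g.val x (K x) u := fun u ↦ rfl
  set ψ : TangentSpace I x →ₗ[ℝ] ℝ :=
    { toFun := fun u ↦ g.val x (T u) (K x)
      map_add' := fun u v ↦ by simp only [map_add, add_apply]
      map_smul' := fun r u ↦ by simp only [map_smul, smul_apply, RingHom.id_apply] } with hψdef
  have hψ : ∀ u, ψ u = g.val x (T u) (K x) := fun u ↦ rfl
  obtain ⟨c, hc⟩ := exists_eq_mul_of_ker_le (x := x) φ ψ (fun z hz ↦ by
    obtain ⟨s, hs⟩ := hTperp z (by rwa [hφ] at hz)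
    rw [hψ, hs, map_smul, smul_apply, smul_eq_mul, g.symm x (K x) (K x), hKK, mul_zero])
  have hc' : ∀ u, g.val x (T u) (K x) = c * g.val x (K x) u := fun u ↦ hc u
  -- the projection `prj` onto `K^⊥` along `u₀`, and `T = T ∘ prj + φ' ⊗ T u₀`
  set φ' : TangentSpace I x →ₗ[ℝ] ℝ := (g.val x (K x) u₀)⁻¹ • φ with hφ'def
  have hφ' : ∀ u, φ' u = (g.val x (K x) u₀)⁻¹ * g.val x (K x) u := fun u ↦ rfl
  have hφ'u : φ' u₀ = 1 := by rw [hφ', inv_mul_cancel₀ hu₀]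
  have hφ'K : φ' (K x) = 0 := by rw [hφ', hKK, mul_zero]
  set prj : TangentSpace I x →ₗ[ℝ] TangentSpace I x := LinearMap.id - φ'.smulRight u₀ with hprjdef
  have hprj : ∀ u, prj u = u - φ' u • u₀ := fun u ↦ rfl
  have hprjK : ∀ u, g.val x (K x) (prj u) = 0 := by
    intro u
    rw [hprj, map_sub, map_smul, smul_eq_mul, hφ']
    field_simp
    ring
  -- `T ∘ prj = β ⊗ K` with `β u = g(T (prj u), u₀)/g(K, u₀)`
  set β : TangentSpace I x →ₗ[ℝ] ℝ :=
    { toFun := fun u ↦ (g.val x (K x) u₀)⁻¹ * g.val x (T (prj u)) u₀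
      map_add' := fun u v ↦ by simp only [map_add, add_apply]; ring
      map_smul' := fun r u ↦ by
        simp only [map_smul, smul_apply, smul_eq_mul, RingHom.id_apply]; ring } with hβdef
  have hβ : ∀ u, β u = (g.val x (K x) u₀)⁻¹ * g.val x (T (prj u)) u₀ := fun u ↦ rfl
  have hTprj : T.comp prj = β.smulRight (K x) := by
    ext u
    obtain ⟨s, hs⟩ := hTperp (prj u) (hprjK u)
    rw [LinearMap.smulRight_apply, hβ u, LinearMap.comp_apply, hs, map_smul, smul_apply,
      smul_eq_mul, g.symm x (K x) u₀, ← mul_assoc, mul_comm _ s, mul_assoc, inv_mul_cancel₀ hu₀',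
      mul_one]
  have hTdec : T = T.comp prj + φ'.smulRight (T u₀) := by
    ext u
    rw [LinearMap.add_apply, LinearMap.comp_apply, LinearMap.smulRight_apply, hprj, map_sub,
      map_smul]
    abel
  have hβK : β (K x) = 0 := by
    rw [hβ]
    have hprjKx : prj (K x) = K x := by rw [hprj, hφ'K, zero_smul, sub_zero]
    rw [hprjKx, hT]
    have : g.riemann x (K x) (K x) X = 0 := by
      change g.leviCivita.curvature x (K x) (K x) X = 0
      exact g.leviCivita.curvature_self (K x) X
    rw [this, map_zero, zero_apply, mul_zero]
  have htrace : LinearMap.trace ℝ _ T = c := by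
    rw [hTdec, map_add, hTprj, LinearMap.trace_smulRight, LinearMap.trace_smulRight, hβK, zero_add,
      hφ', g.symm x (K x) (T u₀), hc' u₀]
    field_simp
  -- vacuum: the trace is `Ric(K, X) = 0`
  have hc0 : c = 0 := by
    rw [← htrace]
    exact hric
  -- conclude from `★`
  have hRm : g.val x (g.riemann x X (K x) u₀) (K x) = 0 := by
    have hps := hLC.val_curvature_pair_symm h2 x X (K x) u₀ (K x)
    change g.val x (g.riemann x X (K x) u₀) (K x) = g.val x (g.riemann x u₀ (K x) X) (K x) at hps
    rw [hps, ← hT, hc' u₀, hc0, zero_mul]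
  rw [hRm] at hstar
  have hmain : mvfderiv I κf x X * g.val x (K x) u₀ = 0 := by
    have h1 : lam * g.val x (g.leviCivita K x u₀) (K x) = lam * (-κf x * g.val x (K x) u₀) := by
      rw [hpt]
    nlinarith [hstar, h1]
  exact (mul_eq_zero.mp hmain).resolve_right hu₀

end Trace

/-- **Registered sub-goal form of step E4** (closed statement over `E4`-charted manifolds, crux
stmt-FinalStateConjecture-17840): the infinitesimal zeroth law `dκ̃_x(K^⊥) = 0` in vacuum. -/
theorem stub_mvfderiv_kap_eq_zero : ∀ (M : Type) [TopologicalSpace M] [ChartedSpace E4 M] [IsManifold (𝓡 4) ∞ M] (g : PseudoRiemannianMetric (𝓡 4) ∞ E4 (TangentSpace (𝓡 4) : M → Type _)) [g.HasLeviCivita] (K : Π x : M, TangentSpace (𝓡 4) x) (κf : M → ℝ) (S : Set M) (x : M), g.IsKillingField K → (∀ᶠ y in 𝓝 x, ContMDiffAt (𝓡 4) 𝓘(ℝ, ℝ) ∞ κf y) → x ∈ S → (∀ᶠ y in 𝓝 x, g.val y (K y) (K y) = 0 → y ∈ S) → (∀ᶠ y in 𝓝 x, y ∈ S → g.val y (K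 y) (K y) = 0 ∧ ∀ v, g.val y (g.leviCivita K y v) (K y) = -(κf y) * g.val y (K y) v) → κf x ≠ 0 → K x ≠ 0 → ∀ X : TangentSpace (𝓡 4) x, mvfderiv (𝓡 4) (fun y ↦ g.val y (K y) (K y)) x X = 0 → g.ricci x (K x) X = 0 → mvfderiv (𝓡 4) κf x X = 0 :=
  fun _ _ _ _ _ _ _ _ _ _ hK hκ hx hlevel hS hkx hKx _ hX hric ↦
    mvfderiv_kap_eq_zero hK hκ hx hlevel hS hkx hKx hX hric

end Summit.FinalStateConjecture.FinalStateConjecture.Theorems.HawkingExtensionIsKerr.SketchIdeator2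

end
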